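import Literature.NumberTheory.Automorphic.DoubledUnitaryRankOneReduction
import Literature.NumberTheory.Automorphic.UnitaryGroupOfFormAdelicTopology
import HarnessLib

/-!
# Reduction theory for the Borel of `U(1,1)_{E/F}` in RAY FORM: `B(𝔸) = U(F) · D(z_E(r)) · C`, `r ≥ r₀`, `C ⊆ U(𝔸)` compact

Topic `NumberTheory/Automorphic`; namespace `Literature.NumberTheory.Automorphic.DoubledUnitary.RankOneReduction`.
KERNEL ONLY (theorems; no definition, no named fact): the consumer-shaped corollaries of
★ `exists_borel_reduction` (Weil's Lemma 20 of *Sur la formule de Siegel…* (1965) n° 47 for the rank-one doubled unitary group,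
Borel's reduction theory for `U(1,1)_{E/F}`) used by the boundedness step of the Siegel–Weil formula in Weil's convergent range.

Let `E/F` be a quadratic extension of number fields with `Gal(E/F) = {1, c}`, `δ ∈ Eˣ` with `c δ = -δ`, and
`U = U(c ⊗ 1, J₁)(𝔸_F) ≤ GL₂(𝔸_E)` (`J₁ = !![0,1;1,0]`, the tree's `unitaryGroupOfForm (UnitaryGroup.conjAdele F E c) J₁`).
Write `z_E(r) := posRealIdele E r ∈ 𝕀_E` (`r > 0`) for the positive real scalar idele.

* `map_baseChange_eq_of_mem_siegelCone_two` — an element of the Siegel cone `A_{T₀}(t)` of `SL₂ /F` (★ `siegelCone 2 F t`), base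
  changed to `𝔸_E`, IS the ray element `diag(z_E(s), z_E(s)⁻¹)` with `t ≤ s²` (★ `AdeleRing.ideleBaseChange_posRealIdele`);
* `conjAdele_posRealIdele`, `diag_posRealIdele_eq` — `z_E(r)` is `c ⊗ 1`-fixed, so the Levi element
  `d(z_E(r)) = diag(z_E(r), (c̄ z_E(r))⁻¹)` of `U(1,1)` is `diag(z_E(r), z_E(r)⁻¹)`, and it lies in `U`
  (`diag_posRealIdele_mem_unitaryGroupOfForm`);
* **`exists_borel_reduction_ray`** — there are `r₀ : ℝ≥0ˣ` and a COMPACT `C ⊆ U` such that every upper-triangular `b ∈ U`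
  is `b = γ⁻¹ · diag(z_E(r), z_E(r)⁻¹) · k` with `γ ∈ U` `E`-rational (`γ ∈ U(F)`), `r₀ ≤ r` (the CUSP side) and `k ∈ C`;
* **`exists_borel_reduction_ray_inv`** — the same with the torus written the other way round:
  `b = γ⁻¹ · diag(z_E(r)⁻¹, z_E(r)) · k` with `r ≤ r₀` (the two parametrisations `r ↔ r⁻¹` of the one ray);
* `exists_borel_reduction_ray_mem`, `exists_borel_reduction_ray_inv_mem` — MEMBERSHIP FORM `b′⁻¹ · γ · b ∈ C`
  (`b′` the ray point), the shape `proj (q⁻¹ r p) = proj q_k` in which the wide-ray step of the boundedness argument consumes it.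

Proof: pure bookkeeping over ★ `exists_borel_reduction` (`b = γ · ι(a) · k`, `a = diag(z_F(s₀), z_F(s₁))`, `s₀ s₁ = 1`, `t s₁ ≤ s₀`),
closedness of `U(𝔸)` in `GL₂(𝔸_E)` (★ `UnitaryGroup.isClosed_unitaryGroupOfForm_conjAdele`) for the compactness of `C := K ∩ U`, and
`r₀ := √t`.

References: A. Weil, *Sur la formule de Siegel dans la théorie des groupes classiques*, Acta Math. 113 (1965), n° 47 Lemme 20 (p. 67);
A. Borel, *Some finiteness properties of adele groups over number fields*, Publ. IHES 16 (1963), §5.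

Written for the Hodge-CM cell `pub/hodgecm-mathlib`, floor 0, crux H413 (stmt-HodgeConjecture-24833), E-2 child line
`F0_E2SiegelWeilWeilRange`, row SW2c-BOUND (RED) of the assembly sheet `F0/P4/SW2c-BOUND-ASSEMBLY.v0` (A-p16 (g18), 2026-08-31).
HC_CM is proved only modulo the printed citations until rung 0 closes; this file discharges none of them.
-/

noncomputable section

open NumberField IsDedekindDomain Matrix Set
open scoped MatrixGroups NNReal Pointwise

namespace Literature.NumberTheory.Automorphic.DoubledUnitary.RankOneReduction

variable (F E : Type) [Field F] [NumberField F] [Field E] [NumberField E] [Algebra F E] (c : E ≃ₐ[F] E)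

/-! ## §1 The ray element `diag(z_E(r), z_E(r)⁻¹)` -/

/-- `GeneralLinearGroup.map f (diag d) = diag (f ∘ d)`. [folklore] -/
private theorem map_glDiagonal {R S : Type*} [CommRing R] [CommRing S] (f : R →+* S) {n : ℕ} (d : Fin n → Rˣ) :
    Matrix.GeneralLinearGroup.map f (glDiagonal n R d) = glDiagonal n S fun i => Units.map (f : R →* S) (d i) := by
  refine Units.ext ?_
  change f.mapMatrix (glDiagonal n R d : Matrix (Fin n) (Fin n) R) = _
  rw [coe_glDiagonal, coe_glDiagonal, RingHom.mapMatrix_apply, Matrix.diagonal_map (map_zero f)]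
  rfl

/-- **The positive real scalar idele is `Gal(E/F)`-fixed**: `(c ⊗ 1)(z_E(r)) = z_E(r)` — it is the base change of
`z_F(r)` (★ `AdeleRing.ideleBaseChange_posRealIdele`) and `c ⊗ 1` fixes `𝔸_F ⊆ 𝔸_E` (★ `AdeleRing.smul_baseChange`).
[cite: Borel1963, §5] -/
theorem conjAdele_posRealIdele (r : ℝ≥0ˣ) :
    UnitaryGroup.conjAdele F E c ((posRealIdele E r : (AdeleRing (𝓞 E) E)ˣ) : AdeleRing (𝓞 E) E) =
      ((posRealIdele E r : (AdeleRing (𝓞 E) E)ˣ) : AdeleRing (𝓞 E) E) := by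
  rw [← AdeleRing.ideleBaseChange_posRealIdele F E r, AdeleRing.coe_ideleBaseChange, UnitaryGroup.conjAdele_apply,
    AdeleRing.smul_baseChange]

/-- Units form of `conjAdele_posRealIdele`: `Units.map (c ⊗ 1) (z_E(r)) = z_E(r)`. [cite: Borel1963, §5] -/
theorem map_conjAdele_posRealIdele (r : ℝ≥0ˣ) :
    Units.map (UnitaryGroup.conjAdele F E c : AdeleRing (𝓞 E) E →* AdeleRing (𝓞 E) E) (posRealIdele E r) =
      posRealIdele E r :=
  Units.ext (conjAdele_posRealIdele F E c r)

/-- **The Levi element `d(z_E(r)) = diag(z_E(r), (c̄ z_E(r))⁻¹)` of `U(1,1)` at the positive real scalar idele is the ray element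
`diag(z_E(r), z_E(r)⁻¹)`.** [cite: GelbartRogawski1991, §1] -/
theorem diag_posRealIdele_eq (r : ℝ≥0ˣ) :
    glDiagonal 2 (AdeleRing (𝓞 E) E)
        ![posRealIdele E r, (Units.map (UnitaryGroup.conjAdele F E c : AdeleRing (𝓞 E) E →* AdeleRing (𝓞 E) E)
          (posRealIdele E r))⁻¹] =
      glDiagonal 2 (AdeleRing (𝓞 E) E) ![posRealIdele E r, (posRealIdele E r)⁻¹] := by
  rw [map_conjAdele_posRealIdele]

/-- **The ray element lies in `U(1,1)(𝔸_F)`**: `diag(z_E(r), z_E(r)⁻¹) ∈ U(c ⊗ 1, J₁)`. [cite: GelbartRogawski1991, §1] -/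
theorem diag_posRealIdele_mem_unitaryGroupOfForm (r : ℝ≥0ˣ) :
    glDiagonal 2 (AdeleRing (𝓞 E) E) ![posRealIdele E r, (posRealIdele E r)⁻¹] ∈
      unitaryGroupOfForm (UnitaryGroup.conjAdele F E c)
        (!![(0 : AdeleRing (𝓞 E) E), 1; 1, 0] : Matrix (Fin 2) (Fin 2) (AdeleRing (𝓞 E) E)) := by
  refine glDiagonal_mem_unitaryGroupOfForm (UnitaryGroup.conjAdele F E c) ?_ ?_
  · rw [conjAdele_posRealIdele]
    exact (posRealIdele E r).mul_inv
  · calc UnitaryGroup.conjAdele F E c (((posRealIdele E r)⁻¹ : (AdeleRing (𝓞 E) E)ˣ) : AdeleRing (𝓞 E) E) *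
          ((posRealIdele E r : (AdeleRing (𝓞 E) E)ˣ) : AdeleRing (𝓞 E) E)
        = UnitaryGroup.conjAdele F E c (((posRealIdele E r)⁻¹ : (AdeleRing (𝓞 E) E)ˣ) : AdeleRing (𝓞 E) E) *
          UnitaryGroup.conjAdele F E c ((posRealIdele E r : (AdeleRing (𝓞 E) E)ˣ) : AdeleRing (𝓞 E) E) := by
            rw [conjAdele_posRealIdele]
      _ = 1 := by rw [← map_mul, Units.inv_mul, map_one]

/-- **Base change of the rank-one Siegel cone is the ray.**  For `a ∈ A_{T₀}(t)` (`t > 0`) of `SL₂ /F` — `a = diag(z_F(s₀), z_F(s₁))`,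
`s₀ s₁ = 1`, `t s₁ ≤ s₀` — its base change to `GL₂(𝔸_E)` is `diag(z_E(s), z_E(s)⁻¹)` with `s = s₀` and `t ≤ s²`.
[cite: Borel1963, §5] -/
theorem map_baseChange_eq_of_mem_siegelCone_two {t : ℝ} {a : GL (Fin 2) (AdeleRing (𝓞 F) F)}
    (ha : a ∈ siegelCone 2 F t) :
    ∃ s : ℝ≥0ˣ, t ≤ ((s : ℝ≥0) : ℝ) ^ 2 ∧
      Matrix.GeneralLinearGroup.map (AdeleRing.baseChange F E : AdeleRing (𝓞 F) F →+* AdeleRing (𝓞 E) E) a =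
        glDiagonal 2 (AdeleRing (𝓞 E) E) ![posRealIdele E s, (posRealIdele E s)⁻¹] := by
  obtain ⟨b, hprod, hroot, rfl⟩ := ha
  rw [Fin.prod_univ_two] at hprod
  have h01 : b 1 = (b 0)⁻¹ := by
    rw [eq_inv_iff_mul_eq_one, mul_comm]
    exact Units.ext (NNReal.eq (by simpa using hprod))
  have hroot' : t * ((b 1 : ℝ≥0) : ℝ) ≤ ((b 0 : ℝ≥0) : ℝ) := hroot 0 1 rfl
  refine ⟨b 0, ?_, ?_⟩
  · -- `t ≤ s₀²` from `t s₁ ≤ s₀` and `s₀ s₁ = 1`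
    have hb0 : (0 : ℝ) < ((b 0 : ℝ≥0) : ℝ) := NNReal.coe_pos.2 (pos_iff_ne_zero.2 (b 0).ne_zero)
    have := mul_le_mul_of_nonneg_right hroot' hb0.le
    rw [mul_assoc, mul_comm ((b 1 : ℝ≥0) : ℝ), hprod, mul_one] at this
    simpa [sq] using this
  · rw [posRealDiagonal_apply, map_glDiagonal]
    congr 1
    funext i
    match i with
    | ⟨0, _⟩ =>
      change AdeleRing.ideleBaseChange F E (posRealIdele F (b 0)) = posRealIdele E (b 0)
      exact AdeleRing.ideleBaseChange_posRealIdele F E (b 0)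
    | ⟨1, _⟩ =>
      change AdeleRing.ideleBaseChange F E (posRealIdele F (b 1)) = (posRealIdele E (b 0))⁻¹
      rw [AdeleRing.ideleBaseChange_posRealIdele F E (b 1), h01, map_inv]

/-! ## §2 The reduction theorem in ray form -/

/-- **Reduction theory for the Borel of `U(1,1)_{E/F}`, RAY FORM (cusp side `r ≥ r₀`).**  There are `r₀ > 0` and a COMPACT
`C ⊆ U = U(c ⊗ 1, J₁)(𝔸_F)` such that every upper-triangular `b ∈ U` factors as
`b = γ⁻¹ · diag(z_E(r), z_E(r)⁻¹) · k` with `γ ∈ U` an `E`-rational matrix (`γ ∈ U(F)`), `r₀ ≤ r`, and `k ∈ C`.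
(Weil (1965) n° 47 Lemme 20 (p. 67) `G̃_A = G_k · T'_A · Ω` for the rank-one doubled unitary group; from ★ `exists_borel_reduction`
with `r₀ = √t`, `C = K ∩ U(𝔸)`.) [cite: Weil1965, n° 47 Lemme 20 (p. 67)] -/
theorem exists_borel_reduction_ray [IsGalois F E] (h2 : ∀ σ : E ≃ₐ[F] E, σ = 1 ∨ σ = c) (δ : Eˣ)
    (hcδ : c (δ : E) = -(δ : E)) :
    ∃ r₀ : ℝ≥0ˣ, ∃ C : Set (GL (Fin 2) (AdeleRing (𝓞 E) E)), IsCompact C ∧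
      C ⊆ unitaryGroupOfForm (UnitaryGroup.conjAdele F E c)
            (!![(0 : AdeleRing (𝓞 E) E), 1; 1, 0] : Matrix (Fin 2) (Fin 2) (AdeleRing (𝓞 E) E)) ∧
      ∀ b : GL (Fin 2) (AdeleRing (𝓞 E) E),
        b ∈ unitaryGroupOfForm (UnitaryGroup.conjAdele F E c)
            (!![(0 : AdeleRing (𝓞 E) E), 1; 1, 0] : Matrix (Fin 2) (Fin 2) (AdeleRing (𝓞 E) E)) →
        (b : Matrix (Fin 2) (Fin 2) (AdeleRing (𝓞 E) E)) 1 0 = 0 →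
        ∃ γ ∈ unitaryGroupOfForm (UnitaryGroup.conjAdele F E c)
            (!![(0 : AdeleRing (𝓞 E) E), 1; 1, 0] : Matrix (Fin 2) (Fin 2) (AdeleRing (𝓞 E) E)),
          γ ∈ (Matrix.GeneralLinearGroup.map (algebraMap E (AdeleRing (𝓞 E) E))).range ∧
          ∃ r : ℝ≥0ˣ, r₀ ≤ r ∧ ∃ k ∈ C,
            b = γ⁻¹ * glDiagonal 2 (AdeleRing (𝓞 E) E) ![posRealIdele E r, (posRealIdele E r)⁻¹] * k := by
  obtain ⟨t, ht, K, hKc, hred⟩ := exists_borel_reduction F E c h2 δ hcδ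
  set U := unitaryGroupOfForm (UnitaryGroup.conjAdele F E c)
    (!![(0 : AdeleRing (𝓞 E) E), 1; 1, 0] : Matrix (Fin 2) (Fin 2) (AdeleRing (𝓞 E) E)) with hU
  -- `r₀ := √t`
  have hsqrt : (0 : ℝ≥0) < NNReal.sqrt ⟨t, ht.le⟩ := NNReal.sqrt_pos.2 (by exact_mod_cast ht)
  refine ⟨Units.mk0 (NNReal.sqrt ⟨t, ht.le⟩) hsqrt.ne', K ∩ (U : Set (GL (Fin 2) (AdeleRing (𝓞 E) E))),
    hKc.inter_right (UnitaryGroup.isClosed_unitaryGroupOfForm_conjAdele F E c _), inter_subset_right,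
    fun b hb hb10 => ?_⟩
  obtain ⟨γ, hγU, hγrat, a, ha, k, hkK, hkU, hbeq⟩ := hred b hb hb10
  obtain ⟨s, hts, hmap⟩ := map_baseChange_eq_of_mem_siegelCone_two F E ha
  refine ⟨γ⁻¹, inv_mem hγU, inv_mem hγrat, s, ?_, k, ⟨hkK, hkU⟩, ?_⟩
  · -- `√t ≤ s` from `t ≤ s²`
    change ((Units.mk0 (NNReal.sqrt ⟨t, ht.le⟩) hsqrt.ne' : ℝ≥0ˣ) : ℝ≥0) ≤ (s : ℝ≥0)
    rw [Units.val_mk0, NNReal.sqrt_le_iff_le_sq]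
    exact_mod_cast hts
  · rw [inv_inv, ← hmap]
    exact hbeq

/-- **Reduction theory for the Borel of `U(1,1)_{E/F}`, RAY FORM (parametrisation `r ≤ r₀`).**  The same statement with the torus
element written `diag(z_E(r)⁻¹, z_E(r))` and `r ≤ r₀` (substitute `r ↦ r⁻¹` in `exists_borel_reduction_ray`; which of the two is
«narrow» for the Weil representation is decided by the Levi embedding of the consumer, not here). [cite: Weil1965, n° 47 Lemme 20 (p. 67)] -/
theorem exists_borel_reduction_ray_inv [IsGalois F E] (h2 : ∀ σ : E ≃ₐ[F] E, σ = 1 ∨ σ = c) (δ : Eˣ)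
    (hcδ : c (δ : E) = -(δ : E)) :
    ∃ r₀ : ℝ≥0ˣ, ∃ C : Set (GL (Fin 2) (AdeleRing (𝓞 E) E)), IsCompact C ∧
      C ⊆ unitaryGroupOfForm (UnitaryGroup.conjAdele F E c)
            (!![(0 : AdeleRing (𝓞 E) E), 1; 1, 0] : Matrix (Fin 2) (Fin 2) (AdeleRing (𝓞 E) E)) ∧
      ∀ b : GL (Fin 2) (AdeleRing (𝓞 E) E),
        b ∈ unitaryGroupOfForm (UnitaryGroup.conjAdele F E c)
            (!![(0 : AdeleRing (𝓞 E) E), 1; 1, 0] : Matrix (Fin 2) (Fin 2) (AdeleRing (𝓞 E) E)) →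
        (b : Matrix (Fin 2) (Fin 2) (AdeleRing (𝓞 E) E)) 1 0 = 0 →
        ∃ γ ∈ unitaryGroupOfForm (UnitaryGroup.conjAdele F E c)
            (!![(0 : AdeleRing (𝓞 E) E), 1; 1, 0] : Matrix (Fin 2) (Fin 2) (AdeleRing (𝓞 E) E)),
          γ ∈ (Matrix.GeneralLinearGroup.map (algebraMap E (AdeleRing (𝓞 E) E))).range ∧
          ∃ r : ℝ≥0ˣ, r ≤ r₀ ∧ ∃ k ∈ C,
            b = γ⁻¹ * glDiagonal 2 (AdeleRing (𝓞 E) E) ![(posRealIdele E r)⁻¹, posRealIdele E r] * k := by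
  obtain ⟨r₀, C, hCc, hCU, hred⟩ := exists_borel_reduction_ray F E c h2 δ hcδ
  refine ⟨r₀⁻¹, C, hCc, hCU, fun b hb hb10 => ?_⟩
  obtain ⟨γ, hγU, hγrat, r, hr, k, hkC, hbeq⟩ := hred b hb hb10
  refine ⟨γ, hγU, hγrat, r⁻¹, inv_le_inv' hr, k, hkC, ?_⟩
  rw [map_inv, inv_inv]
  exact hbeq

/-! ## §3 Membership form: `D(r)⁻¹ · γ · b ∈ C` (the shape `proj (q⁻¹ r p) = proj q_k` of the wide-ray step consumes) -/

/-- **Reduction theory for the Borel of `U(1,1)_{E/F}`, MEMBERSHIP FORM (cusp side `r₀ ≤ r`).**  There are `r₀ > 0` and a compact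
`C ⊆ U` such that for every upper-triangular `b ∈ U` there are an `E`-rational `γ ∈ U` and `r ≥ r₀` with
`diag(z_E(r), z_E(r)⁻¹)⁻¹ · γ · b ∈ C` — i.e. `k := b′⁻¹ γ b` lies in the compact set, `b′ = diag(z_E(r), z_E(r)⁻¹)` the ray point
(the form in which the wide-ray step `‖E(ω p Φ)‖ ≤ …` of the Siegel–Weil boundedness argument uses Weil's Lemma 20:
`proj (q⁻¹ r p) = proj q_k`). [cite: Weil1965, n° 47 Lemme 20 (p. 67)] -/
theorem exists_borel_reduction_ray_mem [IsGalois F E] (h2 : ∀ σ : E ≃ₐ[F] E, σ = 1 ∨ σ = c) (δ : Eˣ)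
    (hcδ : c (δ : E) = -(δ : E)) :
    ∃ r₀ : ℝ≥0ˣ, ∃ C : Set (GL (Fin 2) (AdeleRing (𝓞 E) E)), IsCompact C ∧
      C ⊆ unitaryGroupOfForm (UnitaryGroup.conjAdele F E c)
            (!![(0 : AdeleRing (𝓞 E) E), 1; 1, 0] : Matrix (Fin 2) (Fin 2) (AdeleRing (𝓞 E) E)) ∧
      ∀ b : GL (Fin 2) (AdeleRing (𝓞 E) E),
        b ∈ unitaryGroupOfForm (UnitaryGroup.conjAdele F E c)
            (!![(0 : AdeleRing (𝓞 E) E), 1; 1, 0] : Matrix (Fin 2) (Fin 2) (AdeleRing (𝓞 E) E)) →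
        (b : Matrix (Fin 2) (Fin 2) (AdeleRing (𝓞 E) E)) 1 0 = 0 →
        ∃ γ ∈ unitaryGroupOfForm (UnitaryGroup.conjAdele F E c)
            (!![(0 : AdeleRing (𝓞 E) E), 1; 1, 0] : Matrix (Fin 2) (Fin 2) (AdeleRing (𝓞 E) E)),
          γ ∈ (Matrix.GeneralLinearGroup.map (algebraMap E (AdeleRing (𝓞 E) E))).range ∧
          ∃ r : ℝ≥0ˣ, r₀ ≤ r ∧
            (glDiagonal 2 (AdeleRing (𝓞 E) E) ![posRealIdele E r, (posRealIdele E r)⁻¹])⁻¹ * γ * b ∈ C := by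
  obtain ⟨r₀, C, hCc, hCU, hred⟩ := exists_borel_reduction_ray F E c h2 δ hcδ
  refine ⟨r₀, C, hCc, hCU, fun b hb hb10 => ?_⟩
  obtain ⟨γ, hγU, hγrat, r, hr, k, hkC, hbeq⟩ := hred b hb hb10
  refine ⟨γ, hγU, hγrat, r, hr, ?_⟩
  have hk : (glDiagonal 2 (AdeleRing (𝓞 E) E) ![posRealIdele E r, (posRealIdele E r)⁻¹])⁻¹ * γ * b = k := by
    rw [hbeq, ← mul_assoc, ← mul_assoc, mul_assoc _ γ γ⁻¹, mul_inv_cancel, mul_one, inv_mul_cancel, one_mul]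
  rw [hk]
  exact hkC

/-- **Reduction theory for the Borel of `U(1,1)_{E/F}`, MEMBERSHIP FORM (parametrisation `r ≤ r₀`).**  As
`exists_borel_reduction_ray_mem` with the ray point written `diag(z_E(r)⁻¹, z_E(r))` and `r ≤ r₀`. [cite: Weil1965, n° 47 Lemme 20 (p. 67)] -/
theorem exists_borel_reduction_ray_inv_mem [IsGalois F E] (h2 : ∀ σ : E ≃ₐ[F] E, σ = 1 ∨ σ = c) (δ : Eˣ)
    (hcδ : c (δ : E) = -(δ : E)) :
    ∃ r₀ : ℝ≥0ˣ, ∃ C : Set (GL (Fin 2) (AdeleRing (𝓞 E) E)), IsCompact C ∧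
      C ⊆ unitaryGroupOfForm (UnitaryGroup.conjAdele F E c)
            (!![(0 : AdeleRing (𝓞 E) E), 1; 1, 0] : Matrix (Fin 2) (Fin 2) (AdeleRing (𝓞 E) E)) ∧
      ∀ b : GL (Fin 2) (AdeleRing (𝓞 E) E),
        b ∈ unitaryGroupOfForm (UnitaryGroup.conjAdele F E c)
            (!![(0 : AdeleRing (𝓞 E) E), 1; 1, 0] : Matrix (Fin 2) (Fin 2) (AdeleRing (𝓞 E) E)) →
        (b : Matrix (Fin 2) (Fin 2) (AdeleRing (𝓞 E) E)) 1 0 = 0 →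
        ∃ γ ∈ unitaryGroupOfForm (UnitaryGroup.conjAdele F E c)
            (!![(0 : AdeleRing (𝓞 E) E), 1; 1, 0] : Matrix (Fin 2) (Fin 2) (AdeleRing (𝓞 E) E)),
          γ ∈ (Matrix.GeneralLinearGroup.map (algebraMap E (AdeleRing (𝓞 E) E))).range ∧
          ∃ r : ℝ≥0ˣ, r ≤ r₀ ∧
            (glDiagonal 2 (AdeleRing (𝓞 E) E) ![(posRealIdele E r)⁻¹, posRealIdele E r])⁻¹ * γ * b ∈ C := by
  obtain ⟨r₀, C, hCc, hCU, hred⟩ := exists_borel_reduction_ray_mem F E c h2 δ hcδ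
  refine ⟨r₀⁻¹, C, hCc, hCU, fun b hb hb10 => ?_⟩
  obtain ⟨γ, hγU, hγrat, r, hr, hmem⟩ := hred b hb hb10
  refine ⟨γ, hγU, hγrat, r⁻¹, inv_le_inv' hr, ?_⟩
  rw [map_inv, inv_inv]
  exact hmem

/-! ## §4 Any threshold: `r ≥ r₁` for EVERY `r₁ > 0`, at the price of a larger compact set -/

section Threshold

variable (F E : Type) [Field F] [NumberField F] [Field E] [NumberField E] [Algebra F E] (c : E ≃ₐ[F] E)

/-- `diag(z_E a, (z_E a)⁻¹)⁻¹ · diag(z_E b, (z_E b)⁻¹) = diag(z_E (a⁻¹b), (z_E (a⁻¹b))⁻¹)`: the ray is a one-parameter group.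
[cite: Borel1963, §5] -/
theorem diag_posRealIdele_inv_mul (a b : ℝ≥0ˣ) :
    (glDiagonal 2 (AdeleRing (𝓞 E) E) ![posRealIdele E a, (posRealIdele E a)⁻¹])⁻¹ *
        glDiagonal 2 (AdeleRing (𝓞 E) E) ![posRealIdele E b, (posRealIdele E b)⁻¹] =
      glDiagonal 2 (AdeleRing (𝓞 E) E) ![posRealIdele E (a⁻¹ * b), (posRealIdele E (a⁻¹ * b))⁻¹] := by
  rw [← map_inv, ← map_mul]
  congr 1
  funext i
  match i with
  | ⟨0, _⟩ => simp [map_mul, map_inv]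
  | ⟨1, _⟩ => simp [map_mul, map_inv, mul_comm]

/-- The ray `s ↦ diag(z_E(e^s), z_E(e^s)⁻¹)` is continuous (`ℝ → GL₂(𝔸_E)`). [cite: Borel1963, §5] -/
theorem continuous_diag_posRealIdele_exp :
    Continuous fun s : ℝ => glDiagonal 2 (AdeleRing (𝓞 E) E)
      ![posRealIdele E (expUnitNNReal s), (posRealIdele E (expUnitNNReal s))⁻¹] := by
  have hz : Continuous fun s : ℝ => posRealIdele E (expUnitNNReal s) :=
    (continuous_posRealIdele E).comp continuous_expUnitNNReal
  refine (continuous_glDiagonal (n := 2) (AdeleRing (𝓞 E) E)).comp (continuous_pi fun i => ?_)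
  match i with
  | ⟨0, _⟩ => exact hz
  | ⟨1, _⟩ => exact hz.inv

/-- **Reduction theory for the Borel of `U(1,1)_{E/F}`, MEMBERSHIP FORM WITH AN ARBITRARY THRESHOLD.**  For EVERY `r₁ > 0`
there is a compact `C ⊆ U` such that every upper-triangular `b ∈ U` satisfies `diag(z_E r, (z_E r)⁻¹)⁻¹ · γ · b ∈ C` for some
`E`-rational `γ ∈ U` and some `r ≥ r₁` (the segment `r₀ ≤ r ≤ r₁` of the ray is compact and is absorbed into `C`; Siegel sets
may always be shrunk). [cite: Borel1963, §5] [cite: Weil1965, n° 47 Lemme 20 (p. 67)] -/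
theorem exists_borel_reduction_ray_mem_ge [IsGalois F E] (h2 : ∀ σ : E ≃ₐ[F] E, σ = 1 ∨ σ = c) (δ : Eˣ)
    (hcδ : c (δ : E) = -(δ : E)) (r₁ : ℝ≥0ˣ) :
    ∃ C : Set (GL (Fin 2) (AdeleRing (𝓞 E) E)), IsCompact C ∧
      C ⊆ unitaryGroupOfForm (UnitaryGroup.conjAdele F E c)
            (!![(0 : AdeleRing (𝓞 E) E), 1; 1, 0] : Matrix (Fin 2) (Fin 2) (AdeleRing (𝓞 E) E)) ∧
      ∀ b : GL (Fin 2) (AdeleRing (𝓞 E) E),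
        b ∈ unitaryGroupOfForm (UnitaryGroup.conjAdele F E c)
            (!![(0 : AdeleRing (𝓞 E) E), 1; 1, 0] : Matrix (Fin 2) (Fin 2) (AdeleRing (𝓞 E) E)) →
        (b : Matrix (Fin 2) (Fin 2) (AdeleRing (𝓞 E) E)) 1 0 = 0 →
        ∃ γ ∈ unitaryGroupOfForm (UnitaryGroup.conjAdele F E c)
            (!![(0 : AdeleRing (𝓞 E) E), 1; 1, 0] : Matrix (Fin 2) (Fin 2) (AdeleRing (𝓞 E) E)),
          γ ∈ (Matrix.GeneralLinearGroup.map (algebraMap E (AdeleRing (𝓞 E) E))).range ∧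
          ∃ r : ℝ≥0ˣ, r₁ ≤ r ∧
            (glDiagonal 2 (AdeleRing (𝓞 E) E) ![posRealIdele E r, (posRealIdele E r)⁻¹])⁻¹ * γ * b ∈ C := by
  obtain ⟨r₀, C₀, hC₀c, hC₀U, hred⟩ := exists_borel_reduction_ray_mem F E c h2 δ hcδ
  set U := unitaryGroupOfForm (UnitaryGroup.conjAdele F E c)
    (!![(0 : AdeleRing (𝓞 E) E), 1; 1, 0] : Matrix (Fin 2) (Fin 2) (AdeleRing (𝓞 E) E)) with hU
  set D : ℝ≥0ˣ → GL (Fin 2) (AdeleRing (𝓞 E) E) := fun r =>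
    glDiagonal 2 (AdeleRing (𝓞 E) E) ![posRealIdele E r, (posRealIdele E r)⁻¹] with hD
  -- the compact segment of the ray between `r₀ / r₁` and `1`
  set l₀ : ℝ := Real.log (((r₁⁻¹ * r₀ : ℝ≥0ˣ) : ℝ≥0) : ℝ) with hl₀
  set I : Set ℝ := Set.Icc (min l₀ 0) 0 with hI
  set DI : Set (GL (Fin 2) (AdeleRing (𝓞 E) E)) := (fun s : ℝ => D (expUnitNNReal s)) '' I with hDI
  have hDIc : IsCompact DI := isCompact_Icc.image (continuous_diag_posRealIdele_exp E)
  have hDU : ∀ r, D r ∈ U := fun r => diag_posRealIdele_mem_unitaryGroupOfForm F E c r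
  refine ⟨C₀ ∪ DI * C₀, hC₀c.union (hDIc.mul hC₀c), ?_, fun b hb hb10 => ?_⟩
  · rintro x (hx | ⟨y, ⟨s, -, rfl⟩, k, hk, rfl⟩)
    · exact hC₀U hx
    · exact mul_mem (hDU _) (hC₀U hk)
  obtain ⟨γ, hγU, hγrat, r, hr, hmem⟩ := hred b hb hb10
  by_cases h : r₁ ≤ r
  · exact ⟨γ, hγU, hγrat, r, h, Or.inl hmem⟩
  · refine ⟨γ, hγU, hγrat, r₁, le_rfl, Or.inr ?_⟩
    -- `D(r₁)⁻¹ γ b = D(r₁⁻¹ r) · (D(r)⁻¹ γ b)` with `r₁⁻¹ r = e^s`, `s ∈ I`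
    have hfac : (D r₁)⁻¹ * γ * b = D (r₁⁻¹ * r) * ((D r)⁻¹ * γ * b) := by
      simp only [hD]
      rw [← diag_posRealIdele_inv_mul]
      group
    have hs : Real.log (((r₁⁻¹ * r : ℝ≥0ˣ) : ℝ≥0) : ℝ) ∈ I := by
      have hpos : (0 : ℝ) < ((r₁⁻¹ * r : ℝ≥0ˣ) : ℝ≥0) := NNReal.coe_pos.2 (pos_iff_ne_zero.2 (r₁⁻¹ * r).ne_zero)
      have hpos₀ : (0 : ℝ) < ((r₁⁻¹ * r₀ : ℝ≥0ˣ) : ℝ≥0) := NNReal.coe_pos.2 (pos_iff_ne_zero.2 (r₁⁻¹ * r₀).ne_zero)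
      refine ⟨(min_le_left _ _).trans (Real.log_le_log hpos₀ ?_), Real.log_nonpos hpos.le ?_⟩
      · have : ((r₁⁻¹ * r₀ : ℝ≥0ˣ) : ℝ≥0) ≤ ((r₁⁻¹ * r : ℝ≥0ˣ) : ℝ≥0) := by
          rw [Units.val_mul, Units.val_mul]
          exact mul_le_mul' le_rfl hr
        exact_mod_cast this
      · have : ((r₁⁻¹ * r : ℝ≥0ˣ) : ℝ≥0) ≤ 1 := by
          rw [Units.val_mul, Units.val_inv_eq_inv_val, inv_mul_le_iff₀ (pos_iff_ne_zero.2 r₁.ne_zero), mul_one]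
          exact (not_le.1 h).le
        exact_mod_cast this
    change (D r₁)⁻¹ * γ * b ∈ DI * C₀
    rw [hfac]
    refine Set.mul_mem_mul ⟨_, hs, ?_⟩ hmem
    simp only
    rw [expUnitNNReal_log]

/-- **Arbitrary threshold, parametrisation `r ≤ r₁`** (torus element `diag((z_E r)⁻¹, z_E r)`): for EVERY `r₁ > 0` there is a compact
`C ⊆ U` with `diag((z_E r)⁻¹, z_E r)⁻¹ · γ · b ∈ C` for some `E`-rational `γ ∈ U` and some `r ≤ r₁`.
[cite: Borel1963, §5] [cite: Weil1965, n° 47 Lemme 20 (p. 67)] -/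
theorem exists_borel_reduction_ray_inv_mem_le [IsGalois F E] (h2 : ∀ σ : E ≃ₐ[F] E, σ = 1 ∨ σ = c) (δ : Eˣ)
    (hcδ : c (δ : E) = -(δ : E)) (r₁ : ℝ≥0ˣ) :
    ∃ C : Set (GL (Fin 2) (AdeleRing (𝓞 E) E)), IsCompact C ∧
      C ⊆ unitaryGroupOfForm (UnitaryGroup.conjAdele F E c)
            (!![(0 : AdeleRing (𝓞 E) E), 1; 1, 0] : Matrix (Fin 2) (Fin 2) (AdeleRing (𝓞 E) E)) ∧
      ∀ b : GL (Fin 2) (AdeleRing (𝓞 E) E),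
        b ∈ unitaryGroupOfForm (UnitaryGroup.conjAdele F E c)
            (!![(0 : AdeleRing (𝓞 E) E), 1; 1, 0] : Matrix (Fin 2) (Fin 2) (AdeleRing (𝓞 E) E)) →
        (b : Matrix (Fin 2) (Fin 2) (AdeleRing (𝓞 E) E)) 1 0 = 0 →
        ∃ γ ∈ unitaryGroupOfForm (UnitaryGroup.conjAdele F E c)
            (!![(0 : AdeleRing (𝓞 E) E), 1; 1, 0] : Matrix (Fin 2) (Fin 2) (AdeleRing (𝓞 E) E)),
          γ ∈ (Matrix.GeneralLinearGroup.map (algebraMap E (AdeleRing (𝓞 E) E))).range ∧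
          ∃ r : ℝ≥0ˣ, r ≤ r₁ ∧
            (glDiagonal 2 (AdeleRing (𝓞 E) E) ![(posRealIdele E r)⁻¹, posRealIdele E r])⁻¹ * γ * b ∈ C := by
  obtain ⟨C, hCc, hCU, hred⟩ := exists_borel_reduction_ray_mem_ge F E c h2 δ hcδ r₁⁻¹
  refine ⟨C, hCc, hCU, fun b hb hb10 => ?_⟩
  obtain ⟨γ, hγU, hγrat, r, hr, hmem⟩ := hred b hb hb10
  refine ⟨γ, hγU, hγrat, r⁻¹, inv_le_of_inv_le' hr, ?_⟩
  rw [map_inv, inv_inv]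
  exact hmem

end Threshold

end Literature.NumberTheory.Automorphic.DoubledUnitary.RankOneReduction

end
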